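import Summits.HodgeConjecture.HodgeConjecture.Theorems.Ring2AbelianAllWeilDiscriminantProduct
import Literature.AlgebraicGeometry.Motives.SegreHyperplaneClass
import Literature.AlgebraicGeometry.HodgeTheory.WeilSurfaceCMSquare
import Literature.NumberTheory.EllipticCurves.CMEndomorphismOfMulMemLattice
import HarnessLib

/-!
# Ring 2 · AbelianAll (ab-weil-1, gen 8, part 2/3) — every RIGHT-SIGN component of the Weil tower is
  INHABITED: `sign δ = (-1)ⁿ ⟹ ∃ (A, φ, h_K)` of discriminant class `δ` with a non-zero rational Weil class

research route, not a corollary; conditional on HC_CM plus one named minimal statement.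
Cell line: research route conditional on HC_CM; not a corollary; Q11.4-sentence-2 already refuted in dim ≥ 3.
`HC_CM` (`Theses.RankFourFaces.CMAbelianHodge`) does not occur in this file and no case of the Hodge conjecture
is claimed: this is the converse of gen 7's signature theorem, UNCONDITIONALLY. Gen 7
(`weilSign_eq_of_hasWeilDiscriminantNondeg`, `weilClassesComponent_of_weilSign_ne`) proved that a typed component
`(n, d, δ)` — complex abelian `2n`-folds `(A, φ)`, `φ² = -d`, whose `K`-symmetrised hyperplane class
`h_K = d·e^*a + φ^*e^*a` has non-degenerate discriminant class `det H = δ ∈ ℚˣ/Nm(K_dˣ)` — is EMPTY unless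
`sign δ = (-1)ⁿ` (van Geemen 4.14, Lemma 5.2 (4)). Here: for EVERY `n ≥ 1`, `d ≥ 1` and EVERY class `δ` with
`sign δ = (-1)ⁿ` the component is inhabited by a triple carrying a non-zero rational `(n,n)` Weil class
(`weilClassesComponent_inhabited_of_weilSign_eq`), so that "`(n, d, δ)` inhabited ⟺ `sign δ = (-1)ⁿ`"
(`weilClassesComponent_inhabited_iff_sign`). In print this is van Geemen 4.11 / 4.14 ("for any `x` with
`(-1)ⁿx > 0` there is an `n²`-dimensional family … with `det H = x`") via period domains; the tree has no
moduli of abelian varieties, and the proof below is instead the CM TOWER: `det H` is multiplicative under products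
(part 1, `hasWeilDiscriminantNondeg_prod`), the CM square `(E₀ × E₀, √-d × (-√-d))` polarized by
`pr₁^*(m₁η) + pr₂^*(m₂η)` has `det H = [-m₁m₂]` (part 1, `hasWeilDiscriminantNondeg_cmSquare`; the weights are
realised by Segre powers of a projective embedding of `E₀`, `Motives/SegreHyperplaneClass`), every negative class
is `[-m₁m₂]`, and `δ = (δ·[-1])·[-1]` climbs from `n` to `n + 1`; Weil type `(n, n)` is additive
(`finrank_eigenspace_inf_hodgeOneZero_prod`) and holds for the CM square (`exists_weilType_cmSquare`), and a
Weil-type pair has a non-zero rational `(n,n)` Weil class (`exists_isRationalClass_ne_zero_mem_weilClassesOf`,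
Lemma 5.2 (5)–(6)). CONSEQUENCE FOR THE ATLAS (part 3): no open cell of the imaginary-quadratic Weil column is
a statement about the empty set, and the gen-7 closed cells `sign δ ≠ (-1)ⁿ` are exactly the empty ones.

## References
* B. van Geemen, *An introduction to the Hodge conjecture for abelian varieties*, LNM 1594 (1994), 4.11, 4.14,
  Lemma 5.2, 5.3–5.5. [vanGeemen1994HodgeAV]
* R. Hartshorne, *Algebraic Geometry* (1977), II Ex. 5.11–5.12 (Segre). [Hartshorne1977]
* D. Mumford, *Abelian Varieties* (1970), §6 Appl. 1, §19. [MumfordAV1970]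
-/

noncomputable section

set_option linter.dupNamespace false

open CategoryTheory MonoidalCategory AlgebraicGeometry
open Literature.AlgebraicGeometry Literature.AlgebraicGeometry.Motives
open Literature.AlgebraicGeometry.Motives.SegreHyperplaneClass
open Literature.AlgebraicGeometry.HodgeTheory
open Literature.AlgebraicGeometry.VanGeemen1994
open Literature.AlgebraicTopology.SingularHomology
open Literature.Geometry.Kaehler
open Summit.HodgeConjecture.HodgeConjecture.Ring2.Hypotheses

namespace Summit.HodgeConjecture.HodgeConjecture.Ring2.AbelianAll

/-! ### §1 Weil type `(n, n)` is additive under products -/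

/-- **Products of Weil-type pairs are of Weil type**: `(A × B, φ × ψ)` is of Weil type `(n_A + n_B, d)` (the
multiplicity of `i√d` on `H^{1,0}` adds, van Geemen, proof of Lemma 5.2 (3)).
[cite: vanGeemen1994HodgeAV, 4.9 and proof of Lemma 5.2 (3)] -/
theorem isWeilType_prod {A B : AbelianVariety ℂ} {φ : A ⟶ A} {ψ : B ⟶ B} {nA nB d : ℕ}
    (hWA : IsWeilType A φ nA d) (hWB : IsWeilType B ψ nB d) :
    IsWeilType (A.prod B) (AbelianVariety.prodLift (AbelianVariety.fst A B ≫ φ) (AbelianVariety.snd A B ≫ ψ))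
      (nA + nB) d := by
  have hdim' : (A.prod B).dim = 2 * nA + 2 * nB := by rw [AbelianVariety.dim_prod, hWA.dim_eq, hWB.dim_eq]
  have hdim : (A.prod B).dim = 2 * (nA + nB) := by rw [hdim']; ring
  refine ⟨Nat.add_pos_left hWA.pos _, hWA.d_pos, hdim, prodLift_comp_self_eq_neg_nsmul hWA.sq_eq hWB.sq_eq, ?_⟩
  have h := finrank_eigenspace_inf_hodgeOneZero_prod hWA.dim_eq hWB.dim_eq φ ψ (Complex.I * (Real.sqrt d : ℂ))
  rw [hWA.multiplicity_eq, hWB.multiplicity_eq] at h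
  rw [hodgeOneZero_eq_of_eq (isSmoothProjective_of_dim_eq' hdim) (isSmoothProjective_of_dim_eq' hdim') (by ring)]
  exact h

/-- A Weil-type pair carries a NON-ZERO RATIONAL Weil class of Hodge type `(n, n)` (the Weil plane is a plane
defined over `ℚ`, Lemma 5.2 (5), and consists of `(n,n)` classes, 4.10 / Lemma 5.2 (6)).
[cite: vanGeemen1994HodgeAV, 4.10 and Lemma 5.2 (5)–(6)] -/
theorem exists_weilClass_of_isWeilType {A : AbelianVariety ℂ} {φ : A ⟶ A} {n d : ℕ} (hW : IsWeilType A φ n d) :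
    ∃ c ∈ weilClassesOf A φ n d, IsRationalClass c ∧ IsOfHodgeType (2 * n) A.X (2 * n) n n c ∧ c ≠ 0 := by
  obtain ⟨c, hc, hc0, hcr⟩ := exists_isRationalClass_ne_zero_mem_weilClassesOf hW.pos hW.dim_eq hW.d_pos hW.sq_eq
  exact ⟨c, hc, hcr, hW.isOfHodgeType_of_mem_weilClassesOf hc, hc0⟩

/-! ### §2 Segre embeddings with prescribed hyperplane classes -/

/-- **The Segre embedding of two projective embeddings** `e_X ⊗ e_Y ≫ σ` has hyperplane class
`pr_X^* h_X + pr_Y^* h_Y` for every Segre-additive family `g` (`exists_segreHyperplaneClasses`).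
[cite: Hartshorne1977, II Ex. 5.11 and Ex. 5.12] -/
theorem exists_projectiveEmbedding_tensor (g : (N : ℕ) → complexBetti (projectiveSpace N ℂ) 2)
    (hgσ : ∀ n m : ℕ, complexBetti.map (segreEmbedding n m ℂ) 2 (g (n * m + n + m)) =
      complexBetti.map (CartesianMonoidalCategory.fst (projectiveSpace n ℂ) (projectiveSpace m ℂ)) 2 (g n) +
        complexBetti.map (CartesianMonoidalCategory.snd (projectiveSpace n ℂ) (projectiveSpace m ℂ)) 2 (g m))
    {X Y : SchemeOver ℂ} (eX : ProjectiveEmbedding X) (eY : ProjectiveEmbedding Y) :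
    ∃ e : ProjectiveEmbedding (X ⊗ Y), eY.n ≤ e.n ∧
      complexBetti.map e.ι 2 (g e.n) =
        complexBetti.map (CartesianMonoidalCategory.fst X Y) 2 (complexBetti.map eX.ι 2 (g eX.n)) +
          complexBetti.map (CartesianMonoidalCategory.snd X Y) 2 (complexBetti.map eY.ι 2 (g eY.n)) := by
  haveI := isClosedImmersion_tensorHom_left eX.ι eY.ι
  have hci : IsClosedImmersion ((eX.ι ⊗ₘ eY.ι) ≫ segreEmbedding eX.n eY.n ℂ).left := by
    change IsClosedImmersion ((eX.ι ⊗ₘ eY.ι).left ≫ (segreEmbedding eX.n eY.n ℂ).left)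
    infer_instance
  refine ⟨⟨_, (eX.ι ⊗ₘ eY.ι) ≫ segreEmbedding eX.n eY.n ℂ, hci⟩, Nat.le_add_left _ _, ?_⟩
  change complexBetti.map ((eX.ι ⊗ₘ eY.ι) ≫ segreEmbedding eX.n eY.n ℂ) 2 (g (eX.n * eY.n + eX.n + eY.n)) = _
  rw [map_comp_apply', hgσ, map_add, map_tensorHom_map_fst, map_tensorHom_map_snd]

/-- The product `A × B` of two embedded abelian varieties, embedded by Segre, with hyperplane class
`pr_A^* h_A + pr_B^* h_B`. [cite: Hartshorne1977, II Ex. 5.11 and Ex. 5.12] -/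
theorem exists_projectiveEmbedding_prod (g : (N : ℕ) → complexBetti (projectiveSpace N ℂ) 2)
    (hgσ : ∀ n m : ℕ, complexBetti.map (segreEmbedding n m ℂ) 2 (g (n * m + n + m)) =
      complexBetti.map (CartesianMonoidalCategory.fst (projectiveSpace n ℂ) (projectiveSpace m ℂ)) 2 (g n) +
        complexBetti.map (CartesianMonoidalCategory.snd (projectiveSpace n ℂ) (projectiveSpace m ℂ)) 2 (g m))
    {A B : AbelianVariety ℂ} (eA : ProjectiveEmbedding A.X) (eB : ProjectiveEmbedding B.X) :
    ∃ e : ProjectiveEmbedding (A.prod B).X, eB.n ≤ e.n ∧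
      complexBetti.map e.ι 2 (g e.n) =
        complexBetti.map (AbelianVariety.fst A B).hom.hom.hom 2 (complexBetti.map eA.ι 2 (g eA.n)) +
          complexBetti.map (AbelianVariety.snd A B).hom.hom.hom 2 (complexBetti.map eB.ι 2 (g eB.n)) :=
  exists_projectiveEmbedding_tensor g hgσ eA eB

/-- **The weighted Segre embedding of the CM square.** For an elliptic curve `E₀`, weights `m₁, m₂ ≥ 1` and a
Segre-additive rational family `g` (non-zero in positive dimension): a closed immersion `f₀ : E₀ ↪ ℙᴹ`, `M ≥ 1`,
and a projective embedding `e` of `E₀ × E₀` (`s_{m₁-1}(f₀) ⊗ s_{m₂-1}(f₀) ≫ σ`) with `1 ≤ e.n` and hyperplane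
class `e^*g = pr₁^*(m₁η) + pr₂^*(m₂η)`, `η = f₀^*g_M`. [cite: Hartshorne1977, II Ex. 5.11 and Ex. 5.12]
[cite: MumfordAV1970, §6 Application 1] -/
theorem exists_projectiveEmbedding_cmSquare (g : (N : ℕ) → complexBetti (projectiveSpace N ℂ) 2)
    (hgσ : ∀ n m : ℕ, complexBetti.map (segreEmbedding n m ℂ) 2 (g (n * m + n + m)) =
      complexBetti.map (CartesianMonoidalCategory.fst (projectiveSpace n ℂ) (projectiveSpace m ℂ)) 2 (g n) +
        complexBetti.map (CartesianMonoidalCategory.snd (projectiveSpace n ℂ) (projectiveSpace m ℂ)) 2 (g m))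
    (E₀ : AbelianVariety ℂ) {m₁ m₂ : ℕ} (hm₁ : 0 < m₁) (hm₂ : 0 < m₂) :
    ∃ (M : ℕ) (f₀ : E₀.X ⟶ projectiveSpace M ℂ) (e : ProjectiveEmbedding (E₀.prod E₀).X), 1 ≤ M ∧ 1 ≤ e.n ∧
      complexBetti.map e.ι 2 (g e.n) =
        complexBetti.map (AbelianVariety.fst E₀ E₀).hom.hom.hom 2 (((m₁ : ℕ) : ℂ) • complexBetti.map f₀ 2 (g M)) +
          complexBetti.map (AbelianVariety.snd E₀ E₀).hom.hom.hom 2 (((m₂ : ℕ) : ℂ) • complexBetti.map f₀ 2 (g M)) := by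
  obtain ⟨M, f₀, hM, hf₀⟩ := exists_closedImmersion_projectiveSpace_pos E₀
  haveI := hf₀
  obtain ⟨d₁, rfl⟩ : ∃ k, m₁ = k + 1 := ⟨m₁ - 1, by omega⟩
  obtain ⟨d₂, rfl⟩ : ∃ k, m₂ = k + 1 := ⟨m₂ - 1, by omega⟩
  obtain ⟨ιE, hιE⟩ : ∃ ι : E₀.X ⊗ E₀.X ⟶ projectiveSpace (ProjectiveSpace.segrePowDim M d₁ *
      ProjectiveSpace.segrePowDim M d₂ + ProjectiveSpace.segrePowDim M d₁ + ProjectiveSpace.segrePowDim M d₂) ℂ,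
      ι = ((f₀ ≫ ProjectiveSpace.segrePow M ℂ d₁) ⊗ₘ (f₀ ≫ ProjectiveSpace.segrePow M ℂ d₂)) ≫
        segreEmbedding (ProjectiveSpace.segrePowDim M d₁) (ProjectiveSpace.segrePowDim M d₂) ℂ := ⟨_, rfl⟩
  haveI := isClosedImmersion_segrePow_left M d₁
  haveI := isClosedImmersion_segrePow_left M d₂
  haveI : IsClosedImmersion (f₀ ≫ ProjectiveSpace.segrePow M ℂ d₁).left := by
    change IsClosedImmersion (f₀.left ≫ (ProjectiveSpace.segrePow M ℂ d₁).left); infer_instance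
  haveI : IsClosedImmersion (f₀ ≫ ProjectiveSpace.segrePow M ℂ d₂).left := by
    change IsClosedImmersion (f₀.left ≫ (ProjectiveSpace.segrePow M ℂ d₂).left); infer_instance
  haveI := isClosedImmersion_tensorHom_left (X := E₀.X) (Y := E₀.X) (f₀ ≫ ProjectiveSpace.segrePow M ℂ d₁)
    (f₀ ≫ ProjectiveSpace.segrePow M ℂ d₂)
  have hιEci : IsClosedImmersion ιE.left := by
    rw [hιE]
    change IsClosedImmersion (((f₀ ≫ ProjectiveSpace.segrePow M ℂ d₁) ⊗ₘ (f₀ ≫ ProjectiveSpace.segrePow M ℂ d₂)).left ≫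
      (segreEmbedding (ProjectiveSpace.segrePowDim M d₁) (ProjectiveSpace.segrePowDim M d₂) ℂ).left)
    infer_instance
  have hMle : ∀ k, M ≤ ProjectiveSpace.segrePowDim M k := by
    intro k
    cases k with
    | zero => exact le_rfl
    | succ k => exact Nat.le_add_left _ _
  refine ⟨M, f₀, ⟨_, ιE, hιEci⟩, hM, le_trans hM ((hMle d₂).trans (Nat.le_add_left _ _)), ?_⟩
  change complexBetti.map ιE 2 (g _) = _
  rw [hιE, map_comp_apply', hgσ (ProjectiveSpace.segrePowDim M d₁) (ProjectiveSpace.segrePowDim M d₂), map_add,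
    map_tensorHom_map_fst, map_tensorHom_map_snd, map_comp_apply', map_comp_apply',
    map_segrePow_of_additive g hgσ M d₁, map_segrePow_of_additive g hgσ M d₂]
  simp only [map_smul]
  rfl

/-! ### §3 Negative classes are `[-m₁m₂]` -/

/-- Every class of NEGATIVE sign in `ℚˣ/Nm(K_dˣ)` is `[-(a·b)]` with `a, b ≥ 1` natural numbers
(`q = -a/b ≡ -ab` modulo the square `b²`, a norm). [cite: vanGeemen1994HodgeAV, 4.14] -/
theorem exists_mk_neg_natCast_mul_eq (d : ℕ) (q : ℚˣ) (hq : (q : ℚ) < 0) :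
    ∃ a b : ℕ, 0 < a ∧ 0 < b ∧ ∀ h : ((a : ℚ) * b) ≠ 0,
      (QuotientGroup.mk (-(Units.mk0 _ h)) : weilNormResidueGroup d) = QuotientGroup.mk q := by
  have hnum : (q : ℚ).num < 0 := by
    by_contra h
    exact absurd (Rat.num_nonneg.1 (not_lt.1 h)) (not_le.2 hq)
  refine ⟨(-(q : ℚ).num).toNat, (q : ℚ).den, by omega, (q : ℚ).den_pos, fun h => ?_⟩
  rw [← mk_pow_two_mul_pow_mul d (Units.mk0 ((q : ℚ).den : ℚ) (by positivity)) q 1]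
  congr 1
  ext
  have ha : (((-(q : ℚ).num).toNat : ℕ) : ℚ) = -((q : ℚ).num : ℚ) := by
    have : (((-(q : ℚ).num).toNat : ℕ) : ℤ) = -(q : ℚ).num := Int.toNat_of_nonneg (by omega)
    exact_mod_cast this
  simp only [Units.val_neg, Units.val_mk0, Units.val_mul, Units.val_pow_eq_pow_val]
  rw [ha, ← Rat.mul_den_eq_num]
  ring

/-! ### §4 The CM-square members of the components `(1, d, [-m₁m₂])` -/

/-- **The CM square inhabits `(1, d, [-m₁m₂])`.** For `d ≥ 1` and weights `m₁, m₂ ≥ 1`: the abelian surface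
`(E₀ × E₀, √-d × (-√-d))` (`E₀ = ℂ/(ℤ + ℤ√-d)`), embedded by `s_{m₁-1}(f₀) ⊗ s_{m₂-1}(f₀) ≫ σ`, is of Weil type
`(1, d)`, and its `K`-symmetrised hyperplane class `h_K = pr₁^*(2dm₁η) + pr₂^*(2dm₂η)` has NON-DEGENERATE
discriminant class `[-4d²m₁m₂] = [-m₁m₂]` and `h_K² ≠ 0`. [cite: vanGeemen1994HodgeAV, 5.3 and Lemma 5.2 (2)–(4)]
[cite: Hartshorne1977, II Ex. 5.11 and Ex. 5.12] -/
theorem exists_member_one (g : (N : ℕ) → complexBetti (projectiveSpace N ℂ) 2)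
    (hgr : ∀ N : ℕ, IsRationalClass (g N)) (hgnz : ∀ N : ℕ, 1 ≤ N → g N ≠ 0)
    (hgσ : ∀ n m : ℕ, complexBetti.map (segreEmbedding n m ℂ) 2 (g (n * m + n + m)) =
      complexBetti.map (CartesianMonoidalCategory.fst (projectiveSpace n ℂ) (projectiveSpace m ℂ)) 2 (g n) +
        complexBetti.map (CartesianMonoidalCategory.snd (projectiveSpace n ℂ) (projectiveSpace m ℂ)) 2 (g m))
    {d : ℕ} (hd : 0 < d) {m₁ m₂ : ℕ} (hm₁ : 0 < m₁) (hm₂ : 0 < m₂) (h0 : ((m₁ : ℚ) * m₂) ≠ 0) :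
    ∃ (A : AbelianVariety ℂ) (φ : A ⟶ A) (e : ProjectiveEmbedding A.X), IsWeilType A φ 1 d ∧ 1 ≤ e.n ∧
      HasWeilDiscriminantNondeg A φ 1 d
          ((d : ℂ) • complexBetti.map e.ι 2 (g e.n) + complexBetti.map φ.hom.hom.hom 2 (complexBetti.map e.ι 2 (g e.n)))
          (QuotientGroup.mk (-(Units.mk0 ((m₁ : ℚ) * m₂) h0))) ∧
      lefschetzPow ((d : ℂ) • complexBetti.map e.ι 2 (g e.n) + complexBetti.map φ.hom.hom.hom 2 (complexBetti.map e.ι 2 (g e.n)))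
          (2 * 1 - 1) 2
        ((d : ℂ) • complexBetti.map e.ι 2 (g e.n) + complexBetti.map φ.hom.hom.hom 2 (complexBetti.map e.ι 2 (g e.n))) ≠ 0 := by
  obtain ⟨E₀, ψ₀, hE, hψ⟩ := Literature.NumberTheory.EllipticCurves.CMEndomorphism.exists_cmCurve_sqrt_neg d hd
  obtain ⟨M, f₀, e, hM, hen, hecl⟩ := exists_projectiveEmbedding_cmSquare g hgσ E₀ hm₁ hm₂
  obtain ⟨hBdim, -, hΨ, up, um, hup, hum, -, hH, hup0, -⟩ := exists_weilType_cmSquare hE hd hψ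
  -- Weil type `(1, d)` of the square, from its non-zero `(1,1)` Weil class `u₊ + u₋`
  have hdis := disjoint_weilClassesPlus_weilClassesMinus (A := E₀.prod E₀)
    (φ := AbelianVariety.prodLift (AbelianVariety.fst E₀ E₀ ≫ ψ₀) (AbelianVariety.snd E₀ E₀ ≫ (-ψ₀))) one_pos hd
  have hc0 : up + um ≠ 0 := by
    intro h
    have hup' : up ∈ weilClassesMinus (E₀.prod E₀)
        (AbelianVariety.prodLift (AbelianVariety.fst E₀ E₀ ≫ ψ₀) (AbelianVariety.snd E₀ E₀ ≫ (-ψ₀))) 1 d := by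
      rw [eq_neg_of_add_eq_zero_left h]; exact Submodule.neg_mem _ hum
    exact hup0 (Submodule.disjoint_def.1 hdis up hup hup')
  have hW : IsWeilType (E₀.prod E₀)
      (AbelianVariety.prodLift (AbelianVariety.fst E₀ E₀ ≫ ψ₀) (AbelianVariety.snd E₀ E₀ ≫ (-ψ₀))) 1 d :=
    isWeilType_of_weilClass_ne_zero one_pos hd hBdim hΨ
      (Submodule.add_mem _ (weilClassesPlus_le_weilClassesOf _ _ 1 d hup) (weilClassesMinus_le_weilClassesOf _ _ 1 d hum))
      hc0 hH
  -- `η = f₀^* g_M` is rational and non-zero (else `h_K = 0`, contradicting non-degeneracy, Lemma 5.2 (1))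
  have hηr : IsRationalClass (complexBetti.map f₀ 2 (g M)) := (hgr M).pullback (AlgPoints.mapContinuous (L := ℂ) f₀)
  have hη0 : complexBetti.map f₀ 2 (g M) ≠ 0 := by
    intro h0'
    obtain ⟨δ, hδ⟩ := exists_hasWeilDiscriminantNondeg one_pos hBdim hd hΨ e (hgr _) (hgnz _ hen)
    have hcl : complexBetti.map e.ι 2 (g e.n) = 0 := by
      rw [hecl, h0', smul_zero, smul_zero, map_zero, map_zero, add_zero]
    rw [hcl, map_zero, smul_zero, add_zero] at hδ
    exact not_hasWeilDiscriminantNondeg_zero one_pos δ hδ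
  -- `(±√-d)^* = d` on `H²(E₀)`
  have h2 : ∀ x : complexBetti E₀.X 2, complexBetti.map ψ₀.hom.hom.hom 2 x = (d : ℂ) • x :=
    fun x => cmCurve_map_two hE hd hψ x
  have hψ' : (-ψ₀) ≫ (-ψ₀) = -(d • 𝟙 E₀) := by rw [Preadditive.neg_comp_neg]; exact hψ
  have h2' : ∀ x : complexBetti E₀.X 2, complexBetti.map (-ψ₀).hom.hom.hom 2 x = (d : ℂ) • x :=
    fun x => cmCurve_map_two hE hd hψ' x
  have hs₁ : ((2 * d * m₁ : ℕ) : ℚ) ≠ 0 := by positivity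
  have hs₂ : ((2 * d * m₂ : ℕ) : ℚ) ≠ 0 := by positivity
  -- `h_K = pr₁^*(2dm₁ η) + pr₂^*(2dm₂ η)`
  have hK : (d : ℂ) • complexBetti.map e.ι 2 (g e.n) +
      complexBetti.map (AbelianVariety.prodLift (AbelianVariety.fst E₀ E₀ ≫ ψ₀)
        (AbelianVariety.snd E₀ E₀ ≫ (-ψ₀))).hom.hom.hom 2 (complexBetti.map e.ι 2 (g e.n)) =
      complexBetti.map (AbelianVariety.fst E₀ E₀).hom.hom.hom 2
          ((((2 * d * m₁ : ℕ) : ℚ) : ℂ) • complexBetti.map f₀ 2 (g M)) +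
        complexBetti.map (AbelianVariety.snd E₀ E₀).hom.hom.hom 2
          ((((2 * d * m₂ : ℕ) : ℚ) : ℂ) • complexBetti.map f₀ 2 (g M)) := by
    have e₁ : (d : ℂ) * ((m₁ : ℕ) : ℂ) + (d : ℂ) * ((m₁ : ℕ) : ℂ) = (((2 * d * m₁ : ℕ) : ℚ) : ℂ) := by
      push_cast; ring
    have e₂ : (d : ℂ) * ((m₂ : ℕ) : ℂ) + (d : ℂ) * ((m₂ : ℕ) : ℂ) = (((2 * d * m₂ : ℕ) : ℚ) : ℂ) := by
      push_cast; ring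
    rw [hecl, smul_add_map_prodLift, h2, h2', smul_smul, ← add_smul, e₁, smul_smul, ← add_smul, e₂]
  obtain ⟨hN, htop⟩ := hasWeilDiscriminantNondeg_cmSquare hE hd hψ hηr hη0 hs₁ hs₂
  have hδ : (QuotientGroup.mk (-(Units.mk0 _ hs₁ * Units.mk0 _ hs₂)) : weilNormResidueGroup d) =
      QuotientGroup.mk (-(Units.mk0 ((m₁ : ℚ) * m₂) h0)) := by
    rw [← mk_pow_two_mul_pow_mul d (Units.mk0 ((2 * d : ℕ) : ℚ) (by positivity))
      (-(Units.mk0 ((m₁ : ℚ) * m₂) h0)) 1]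
    congr 1
    ext
    simp only [Units.val_neg, Units.val_mul, Units.val_pow_eq_pow_val, Units.val_mk0]
    push_cast
    ring
  refine ⟨E₀.prod E₀, _, e, hW, hen, ?_, ?_⟩
  · rw [hK, ← hδ]; exact hN
  · rw [hK]; exact htop

/-! ### §5 The CM tower: every right-sign component is inhabited -/

/-- **The CM tower** (induction on `n`): for every `n ≥ 1`, `d ≥ 1` and every class `δ` with `sign δ = (-1)ⁿ`
there is an embedded Weil-type pair `(A, φ, e)` of type `(n, d)` whose `K`-symmetrised hyperplane class has
non-degenerate discriminant class `δ` and non-zero top power: the CM square for `n = 1` (`δ = [-ab]`), and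
`(n, δ·[-1]) × (1, [-1]) ↦ (n + 1, δ)` by multiplicativity of `det H`. [cite: vanGeemen1994HodgeAV, 4.11, 4.14 and Lemma 5.2 (3)] -/
theorem exists_member (g : (N : ℕ) → complexBetti (projectiveSpace N ℂ) 2)
    (hgr : ∀ N : ℕ, IsRationalClass (g N)) (hgnz : ∀ N : ℕ, 1 ≤ N → g N ≠ 0)
    (hgσ : ∀ n m : ℕ, complexBetti.map (segreEmbedding n m ℂ) 2 (g (n * m + n + m)) =
      complexBetti.map (CartesianMonoidalCategory.fst (projectiveSpace n ℂ) (projectiveSpace m ℂ)) 2 (g n) +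
        complexBetti.map (CartesianMonoidalCategory.snd (projectiveSpace n ℂ) (projectiveSpace m ℂ)) 2 (g m))
    {n d : ℕ} (hn : 1 ≤ n) (hd : 0 < d) {δ : weilNormResidueGroup d} (hδ : weilSign d δ = (-1) ^ n) :
    ∃ (A : AbelianVariety ℂ) (φ : A ⟶ A) (e : ProjectiveEmbedding A.X), IsWeilType A φ n d ∧ 1 ≤ e.n ∧
      HasWeilDiscriminantNondeg A φ n d
          ((d : ℂ) • complexBetti.map e.ι 2 (g e.n) + complexBetti.map φ.hom.hom.hom 2 (complexBetti.map e.ι 2 (g e.n)))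
          δ ∧
      lefschetzPow ((d : ℂ) • complexBetti.map e.ι 2 (g e.n) + complexBetti.map φ.hom.hom.hom 2 (complexBetti.map e.ι 2 (g e.n)))
          (2 * n - 1) 2
        ((d : ℂ) • complexBetti.map e.ι 2 (g e.n) + complexBetti.map φ.hom.hom.hom 2 (complexBetti.map e.ι 2 (g e.n))) ≠ 0 := by
  induction n, hn using Nat.le_induction generalizing δ with
  | base =>
    obtain ⟨q, rfl⟩ := QuotientGroup.mk_surjective δ
    -- (`^` on `ℤˣ` with a variable exponent elaborates to `Int.instUnitsPow`; the typed ascription matches it)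
    rw [show ((-1 : ℤˣ) ^ (1 : ℕ)) = -1 from pow_one _, weilSign_mk, ratSign_eq_neg_one_iff] at hδ
    obtain ⟨a, b, ha, hb, hab⟩ := exists_mk_neg_natCast_mul_eq d q hδ
    have h0 : ((a : ℚ) * b) ≠ 0 := by positivity
    rw [← hab h0]
    exact exists_member_one g hgr hgnz hgσ hd ha hb h0
  | succ n hn IH =>
    have h11 : (((1 : ℕ) : ℚ) * (1 : ℕ)) ≠ 0 := by norm_num
    have hneg : ((-(Units.mk0 _ h11) : ℚˣ) : ℚ) < 0 := by simp
    have hδ' : weilSign d (δ * QuotientGroup.mk (-(Units.mk0 _ h11))) = (-1) ^ n := by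
      rw [map_mul, hδ, weilSign_mk_of_neg d hneg, show ((-1 : ℤˣ) ^ (n + 1 : ℕ)) = (-1) ^ (n : ℕ) * (-1) from pow_succ _ _,
        mul_assoc, show ((-1 : ℤˣ) * -1) = 1 from by simp, mul_one]
    obtain ⟨A, φ, eA, hWA, heA, hNA, htA⟩ := IH hδ'
    obtain ⟨B, ψ, eB, hWB, heB, hNB, htB⟩ := exists_member_one g hgr hgnz hgσ hd one_pos one_pos h11
    obtain ⟨e, hen, hecl⟩ := exists_projectiveEmbedding_prod g hgσ eA eB
    obtain ⟨hP, htP⟩ := hasWeilDiscriminantNondeg_prod hWA.pos hWB.pos hWA.dim_eq hWB.dim_eq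
      (isRationalClass_ksymm d φ eA (hgr _)) (isRationalClass_ksymm d ψ eB (hgr _)) htA htB hNA hNB
    have hK : (d : ℂ) • complexBetti.map e.ι 2 (g e.n) +
        complexBetti.map (AbelianVariety.prodLift (AbelianVariety.fst A B ≫ φ)
          (AbelianVariety.snd A B ≫ ψ)).hom.hom.hom 2 (complexBetti.map e.ι 2 (g e.n)) =
        complexBetti.map (AbelianVariety.fst A B).hom.hom.hom 2
            ((d : ℂ) • complexBetti.map eA.ι 2 (g eA.n) + complexBetti.map φ.hom.hom.hom 2 (complexBetti.map eA.ι 2 (g eA.n))) +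
          complexBetti.map (AbelianVariety.snd A B).hom.hom.hom 2
            ((d : ℂ) • complexBetti.map eB.ι 2 (g eB.n) + complexBetti.map ψ.hom.hom.hom 2 (complexBetti.map eB.ι 2 (g eB.n))) := by
      rw [hecl]; exact smul_add_map_prodLift φ ψ (d : ℂ) _ _
    have hxx : (-(Units.mk0 _ h11) : ℚˣ) * -(Units.mk0 _ h11) = 1 := by ext; simp
    have hmul : δ * QuotientGroup.mk (-(Units.mk0 _ h11)) * QuotientGroup.mk (-(Units.mk0 _ h11)) = δ := by
      rw [mul_assoc, ← QuotientGroup.mk_mul, hxx, QuotientGroup.mk_one, mul_one]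
    refine ⟨A.prod B, _, e, isWeilType_prod hWA hWB, le_trans heB hen, ?_, ?_⟩
    · rw [hK, ← hmul]; exact hP
    · rw [hK]; exact htP

/-- **Every right-sign component of the imaginary-quadratic Weil tower is INHABITED** (converse of gen 7's
`weilSign_eq_of_hasWeilDiscriminantNondeg`; van Geemen 4.11 / 4.14 by the CM tower instead of period domains).
For `n ≥ 1`, `d ≥ 1` and `δ ∈ ℚˣ/Nm(K_dˣ)` with `sign δ = (-1)ⁿ` there is a complex abelian `2n`-fold `(A, φ)`,
`φ ≫ φ = -d`, with a `K`-symmetrised hyperplane class `d·e^*a + φ^*e^*a` (`a ≠ 0` rational) of NON-DEGENERATE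
discriminant class `δ` AND a non-zero rational `(n,n)` class in its Weil plane — so the premises of
`Hypotheses.WeilClassesComponent n d δ` are jointly satisfiable. [cite: vanGeemen1994HodgeAV, 4.11, 4.14, Lemma 5.2 and 5.3–5.5] -/
theorem weilClassesComponent_inhabited_of_weilSign_eq {n d : ℕ} (hn : 0 < n) (hd : 0 < d)
    {δ : weilNormResidueGroup d} (hδ : weilSign d δ = (-1) ^ n) :
    ∃ (A : AbelianVariety ℂ) (φ : A ⟶ A) (e : ProjectiveEmbedding A.X)
      (a : complexBetti (projectiveSpace e.n ℂ) 2) (c : complexBetti A.X (2 * n)),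
      A.dim = 2 * n ∧ IsSmoothProjective (2 * n) A.X ∧ φ ≫ φ = -(d • 𝟙 A) ∧ IsRationalClass a ∧ a ≠ 0 ∧
        HasWeilDiscriminantNondeg A φ n d
          ((d : ℂ) • complexBetti.map e.ι 2 a + complexBetti.map φ.hom.hom.hom 2 (complexBetti.map e.ι 2 a)) δ ∧
        c ∈ weilClassesOf A φ n d ∧ IsRationalClass c ∧ IsOfHodgeType (2 * n) A.X (2 * n) n n c ∧ c ≠ 0 := by
  obtain ⟨g, hgr, hgnz, hgσ⟩ := exists_segreHyperplaneClasses
  obtain ⟨A, φ, e, hW, hen, hN, -⟩ := exists_member g hgr hgnz hgσ hn hd hδ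
  obtain ⟨c, hc, hcr, hcH, hc0⟩ := exists_weilClass_of_isWeilType hW
  exact ⟨A, φ, e, g e.n, c, hW.dim_eq, hW.isSmoothProjective, hW.sq_eq, hgr _, hgnz _ hen, hN, hc, hcr, hcH, hc0⟩

/-- **`(n, d, δ)` is inhabited ⟺ `sign δ = (-1)ⁿ`** (`n ≥ 1`, `d ≥ 1`): gen 7 (`⇒`, signature `(n, n)`) and the CM
tower (`⇐`). The EMPTY components are exactly the wrong-sign ones. [cite: vanGeemen1994HodgeAV, 4.11, 4.14 and Lemma 5.2 (4)] -/
theorem weilClassesComponent_inhabited_iff_sign {n d : ℕ} (hn : 0 < n) (hd : 0 < d) (δ : weilNormResidueGroup d) :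
    (∃ (A : AbelianVariety ℂ) (φ : A ⟶ A) (e : ProjectiveEmbedding A.X)
      (a : complexBetti (projectiveSpace e.n ℂ) 2) (c : complexBetti A.X (2 * n)),
      A.dim = 2 * n ∧ IsSmoothProjective (2 * n) A.X ∧ φ ≫ φ = -(d • 𝟙 A) ∧ IsRationalClass a ∧ a ≠ 0 ∧
        HasWeilDiscriminantNondeg A φ n d
          ((d : ℂ) • complexBetti.map e.ι 2 a + complexBetti.map φ.hom.hom.hom 2 (complexBetti.map e.ι 2 a)) δ ∧
        c ∈ weilClassesOf A φ n d ∧ IsRationalClass c ∧ IsOfHodgeType (2 * n) A.X (2 * n) n n c ∧ c ≠ 0) ↔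
      weilSign d δ = (-1) ^ n := by
  refine ⟨?_, weilClassesComponent_inhabited_of_weilSign_eq hn hd⟩
  rintro ⟨A, φ, e, a, c, hA, -, hφ, ha, ha0, hN, hc, hcr, hcH, hc0⟩
  exact weilSign_eq_of_hasWeilDiscriminantNondeg (isWeilType_of_weilClass_ne_zero hn hd hA hφ hc hc0 hcH) e ha ha0 hN

/-- **Weil-type pairs with prescribed `det H`** (van Geemen 4.11 on the carriers, with `det H` of 4.14): for
`sign δ = (-1)ⁿ` there is a Weil-type pair `(A, φ)` of type `(n, d)` with an embedding whose `K`-symmetrised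
hyperplane class has discriminant class `δ`. [cite: vanGeemen1994HodgeAV, 4.11 and 4.14] -/
theorem exists_isWeilType_hasWeilDiscriminantNondeg {n d : ℕ} (hn : 0 < n) (hd : 0 < d)
    {δ : weilNormResidueGroup d} (hδ : weilSign d δ = (-1) ^ n) :
    ∃ (A : AbelianVariety ℂ) (φ : A ⟶ A) (e : ProjectiveEmbedding A.X) (a : complexBetti (projectiveSpace e.n ℂ) 2),
      IsWeilType A φ n d ∧ IsRationalClass a ∧ a ≠ 0 ∧
        HasWeilDiscriminantNondeg A φ n d
          ((d : ℂ) • complexBetti.map e.ι 2 a + complexBetti.map φ.hom.hom.hom 2 (complexBetti.map e.ι 2 a)) δ := by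
  obtain ⟨g, hgr, hgnz, hgσ⟩ := exists_segreHyperplaneClasses
  obtain ⟨A, φ, e, hW, hen, hN, -⟩ := exists_member g hgr hgnz hgσ hn hd hδ
  exact ⟨A, φ, e, g e.n, hW, hgr _, hgnz _ hen, hN⟩

end Summit.HodgeConjecture.HodgeConjecture.Ring2.AbelianAll

end
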